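import Mathlib
import HarnessLib
import Summits.QuantumFields.YangMills.Theorems.PencilRigidityNPointIsotropyBandlimit
import Summits.QuantumFields.YangMills.Theorems.PencilRigidityShellRigidityAngleBandLimitExtension

/-!
# The angle band limit with its chart identity (stub `stub_angleBandLimit`,
crux `PencilRigidity.ShellRigidity`, line `thales-slit-exact-cone-type`, stmt-QuantumFields-11685)

Informal statement. Let `K : ℝ⁴ → ℝ` satisfy `|K x| ≤ C(1 + ‖x‖^{-a})` off `0` with `0 < a < 12`,
be invariant under the rotation `R_{π/2}` of the `(0,1)`-plane and under `x₁ ↦ -x₁`, and be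
represented along the time axis, for every level `ε > 0`, by a finite positive measure `μ ε` on
momentum space carried by the light cone `{p₀ ≥ |p₁|}`:
`K((ε+t)e₀ + v) = ∫ e^{-t p₀ + i⟪v,p⟫} d(μ ε)` (`t ≥ 0`, `v ⊥ e₀`). Then for every `t > 0` and
transverse `(y, z)` the angular trace `φ ↦ K(t cos φ, t sin φ, y, z)` is a real trigonometric
polynomial `b₀ + b₁ cos 4φ + b₂ cos 8φ`, and its value at the imaginary angle `iχ` is the chart
integral `∫ exp(-(t ch χ - ε)p₀ - t sh χ p₁ + i(y p₂ + z p₃)) d(μ ε)` at any level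
`0 < ε < t e^{-|χ|}`.

Proof. Fix `t > 0`, `y`, `z`; `g(α) = K(t cos α, t sin α, y, z)` is `π/2`-periodic (`R_{π/2}`) and
even (`x₁ ↦ -x₁`). The charts `H_ε(w) = ∫ exp(-(t cos w - ε)p₀ + i(t sin w p₁ + y p₂ + z p₃)) d(μ ε)`
of the helper file `PencilRigidityShellRigidityAngleBandLimitChart` are holomorphic on the lenses
`{ε < t cos(Re w) e^{-|Im w|}}`, equal `g` at the real points and are bounded by
`C(1 + (t cos(Re w) e^{-|Im w|})^{-a})`. Gluing the levels gives ONE holomorphic function `Φ₀` on the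
strip `|Re w| < π/3` with `Φ₀ = g` on reals and `Φ₀(u - π/2) = Φ₀(u)` near `Re u = π/4`; reducing
`Re w` modulo `π/2` into `[-π/4, π/4)` (`toIcoDiv`) extends it to an ENTIRE `π/2`-periodic function
`Φ` with `Φ = g` on `ℝ` and `‖Φ w‖ ≤ C(1 + (t/2)^{-a}) e^{a|Im w|}` (`stub_angleBandLimitExtension`). The
angular Paley–Wiener theorem of the sibling file `PencilRigidityNPointIsotropyBandlimit`
(`bandlimit_main`, Fourier coefficients by a contour shift, `a < 12 = 4·3`) makes `g` a trigonometric
polynomial `∑_{|k| ≤ 2} c_k e^{4ikθ}`; symmetrising with the evenness of `g` and taking real parts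
gives `g = b₀ + b₁ cos 4θ + b₂ cos 8θ` with real `b` (`cos_expansion`). Finally, for
`0 < ε < t e^{-|χ|}` the point `iχ` lies in the lens of level `ε` together with a small rectangle
around `0`, on which `H_ε - (b₀ + b₁ cos 4w + b₂ cos 8w)` is holomorphic and vanishes at the real
points, hence at `iχ` (`chart_imaginary_angle`), where `cos(4iχ) = ch 4χ` and the chart integrand is
the one displayed (`AngleBandLimit.integrand_mul_I`). References: R. P. Boas, *Entire Functions*
(1954), §6.10; E. C. Titchmarsh, *The Theory of Functions* (1939), §2.5 (all folklore). No
definitions, no named facts.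
-/

noncomputable section

namespace Summit.QuantumFields.YangMills.Cruxes.ShellRigidity.ThalesSlitExactConeType

open MeasureTheory Complex Real
open scoped InnerProductSpace BigOperators

local notation "E4" => EuclideanSpace ℝ (Fin 4)

namespace AngleBandLimit

open Set Filter Metric Topology
open Summit.QuantumFields.YangMills.Theorems.NPointIsotropy.ComplexRotationBandlimit (bandlimit_main)

section Abstract

variable {g : ℝ → ℝ} {H : ℝ → ℂ → ℂ} {t C a : ℝ}

/-! ## Band limitation and the cosine form -/

/-- The five-term trigonometric sum `∑_{|k| ≤ 2} c_k e^{4ikθ}` in cosines and sines. -/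
theorem sum_Icc_two (c : ℤ → ℂ) (θ : ℂ) :
    ∑ k ∈ Finset.Icc (-((2 : ℕ) : ℤ)) (2 : ℕ), c k * cexp (4 * (k : ℂ) * θ * I) =
      c 0 + (c 1 + c (-1)) * Complex.cos (4 * θ) + (c 1 - c (-1)) * (Complex.sin (4 * θ) * I) +
        (c 2 + c (-2)) * Complex.cos (8 * θ) + (c 2 - c (-2)) * (Complex.sin (8 * θ) * I) := by
  have hS : Finset.Icc (-((2 : ℕ) : ℤ)) (2 : ℕ) = {-2, -1, 0, 1, 2} := by
    ext k
    simp only [Nat.cast_ofNat, Finset.mem_Icc, Finset.mem_insert, Finset.mem_singleton]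
    omega
  rw [hS, Finset.sum_insert (by decide), Finset.sum_insert (by decide),
    Finset.sum_insert (by decide), Finset.sum_insert (by decide), Finset.sum_singleton]
  have e : ∀ k : ℤ, cexp (4 * (k : ℂ) * θ * I) =
      Complex.cos (4 * k * θ) + Complex.sin (4 * k * θ) * I := fun k => Complex.exp_mul_I _
  simp only [e]
  push_cast
  rw [show (4 : ℂ) * -2 * θ = -(8 * θ) by ring, show (4 : ℂ) * -1 * θ = -(4 * θ) by ring,
    show (4 : ℂ) * 0 * θ = 0 by ring, show (4 : ℂ) * 1 * θ = 4 * θ by ring,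
    show (4 : ℂ) * 2 * θ = 8 * θ by ring]
  simp only [Complex.cos_neg, Complex.sin_neg, Complex.cos_zero, Complex.sin_zero]
  ring

/-- **The angular trace is `b₀ + b₁ cos 4θ + b₂ cos 8θ`.** The entire extension
(`stub_angleBandLimitExtension`) is band-limited by the angular Paley–Wiener theorem `bandlimit_main`
(`a < 12`): `g θ = ∑_{|k| ≤ 2} c_k e^{4ikθ}`; averaging over `θ ↦ -θ` (evenness of `g`) kills the
sines, and real parts give real coefficients. -/
theorem cos_expansion (ht : 0 < t) (ha : 0 < a) (ha12 : a < 12)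
    (hH : ∀ ε : ℝ, 0 < ε →
      DifferentiableOn ℂ (H ε) {w : ℂ | ε < t * Real.cos w.re * Real.exp (-|w.im|)})
    (hreal : ∀ ε : ℝ, 0 < ε → ∀ α : ℝ, ε ≤ t * Real.cos α → H ε α = g α)
    (hbd : ∀ ε : ℝ, 0 < ε → ∀ w : ℂ, ε < t * Real.cos w.re * Real.exp (-|w.im|) →
      ‖H ε w‖ ≤ C * (1 + (t * Real.cos w.re * Real.exp (-|w.im|)) ^ (-a)))
    (hper : ∀ α : ℝ, g (α + π / 2) = g α) (heven : ∀ α : ℝ, g (-α) = g α) :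
    ∃ b₀ b₁ b₂ : ℝ, ∀ θ : ℝ, g θ = b₀ + b₁ * Real.cos (4 * θ) + b₂ * Real.cos (8 * θ) := by
  obtain ⟨Φ, hd, hperΦ, hbdΦ, hΦg⟩ := stub_angleBandLimitExtension g H t C a ht ha.le hH hreal hbd hper
  obtain ⟨c, -, hexp⟩ := bandlimit_main hd hperΦ hbdΦ
  have h12 : a < 4 * (((2 : ℕ) : ℝ) + 1) := by norm_num; linarith
  refine ⟨(c 0).re, (c 1 + c (-1)).re, (c 2 + c (-2)).re, fun θ => ?_⟩
  have e1 := hexp 2 h12 θ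
  have e2 := hexp 2 h12 (-θ)
  rw [sum_Icc_two, hΦg] at e1
  rw [sum_Icc_two, hΦg, heven] at e2
  simp only [Complex.ofReal_neg, mul_neg, Complex.cos_neg, Complex.sin_neg, neg_mul] at e2
  have key : ((g θ : ℝ) : ℂ) = c 0 + (c 1 + c (-1)) * Complex.cos (4 * θ) +
      (c 2 + c (-2)) * Complex.cos (8 * θ) := by
    linear_combination (e1 + e2) / 2
  have c4 : Complex.cos (4 * (θ : ℂ)) = ((Real.cos (4 * θ) : ℝ) : ℂ) := by push_cast; rfl
  have c8 : Complex.cos (8 * (θ : ℂ)) = ((Real.cos (8 * θ) : ℝ) : ℂ) := by push_cast; rfl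
  rw [c4, c8] at key
  have hre := congrArg Complex.re key
  simp only [Complex.add_re, Complex.mul_re, Complex.ofReal_re, Complex.ofReal_im, mul_zero,
    sub_zero] at hre
  exact hre

/-! ## The chart identity at the imaginary angle -/

/-- **The chart at `iχ`.** If `g = b₀ + b₁ cos 4θ + b₂ cos 8θ` on `ℝ` and `0 < ε < t e^{-|χ|}`,
then `H ε (iχ) = b₀ + b₁ ch 4χ + b₂ ch 8χ`: a rectangle `{|Re w| < s, |Im w| < |χ| + s}` lies in the
lens of level `ε`, the difference `H ε - (b₀ + b₁ cos 4w + b₂ cos 8w)` is holomorphic there and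
vanishes at the real points, hence at `iχ` (`eqOn_rect_of_eqOn_real`), and `cos(4iχ) = ch 4χ`. -/
theorem chart_imaginary_angle (ht : 0 < t)
    (hH : ∀ ε : ℝ, 0 < ε →
      DifferentiableOn ℂ (H ε) {w : ℂ | ε < t * Real.cos w.re * Real.exp (-|w.im|)})
    (hreal : ∀ ε : ℝ, 0 < ε → ∀ α : ℝ, ε ≤ t * Real.cos α → H ε α = g α)
    {b₀ b₁ b₂ : ℝ} (hb : ∀ θ : ℝ, g θ = b₀ + b₁ * Real.cos (4 * θ) + b₂ * Real.cos (8 * θ))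
    {χ ε : ℝ} (hε : 0 < ε) (hεχ : ε < t * Real.exp (-|χ|)) :
    (((b₀ + b₁ * Real.cosh (4 * χ) + b₂ * Real.cosh (8 * χ) : ℝ)) : ℂ) = H ε (χ * I) := by
  -- a margin `s`
  obtain ⟨s, hs0, hs1, hs⟩ : ∃ s : ℝ, 0 < s ∧ s < 1 ∧
      ε < t * Real.cos s * Real.exp (-(|χ| + s)) := by
    have hc : Continuous fun s : ℝ => t * Real.cos s * Real.exp (-(|χ| + s)) := by fun_prop
    have h0 : ε < t * Real.cos 0 * Real.exp (-(|χ| + 0)) := by simpa using hεχ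
    have hev : ∀ᶠ s : ℝ in 𝓝 0, ε < t * Real.cos s * Real.exp (-(|χ| + s)) :=
      hc.continuousAt.eventually_const_lt h0
    have hev1 : ∀ᶠ s : ℝ in 𝓝 (0 : ℝ), s < 1 := Iio_mem_nhds one_pos
    obtain ⟨s, ⟨h1, h2⟩, h3⟩ :=
      (((hev.and hev1).filter_mono nhdsWithin_le_nhds).and
        (self_mem_nhdsWithin : Ioi (0 : ℝ) ∈ 𝓝[>] (0 : ℝ))).exists
    exact ⟨s, h3, h2, h1⟩
  have hsπ : s ≤ π := by linarith [Real.pi_gt_three]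
  -- the rectangle `{|Re w| < s, |Im w| < |χ| + s}` lies in the lens of level `ε`
  have hcosle : ∀ r : ℝ, |r| < s → Real.cos s < Real.cos r := fun r hr => by
    rw [← Real.cos_abs r]
    exact Real.cos_lt_cos_of_nonneg_of_le_pi (abs_nonneg r) hsπ hr
  have hcs : 0 < Real.cos s := by
    have := hε.trans hs
    have h1 : 0 < t * Real.cos s := pos_of_mul_pos_left this (Real.exp_pos _).le
    exact pos_of_mul_pos_right h1 ht.le
  have hsub : {w : ℂ | |w.re - 0| < s ∧ |w.im| < |χ| + s} ⊆
      {w : ℂ | ε < t * Real.cos w.re * Real.exp (-|w.im|)} := by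
    intro w hw
    obtain ⟨hw1, hw2⟩ := hw
    rw [sub_zero] at hw1
    have h1 := hcosle w.re hw1
    have h2 : Real.exp (-(|χ| + s)) < Real.exp (-|w.im|) := Real.exp_lt_exp.2 (by linarith)
    calc ε < t * Real.cos s * Real.exp (-(|χ| + s)) := hs
      _ ≤ t * Real.cos w.re * Real.exp (-(|χ| + s)) := by gcongr
      _ ≤ t * Real.cos w.re * Real.exp (-|w.im|) := by
          have : 0 ≤ t * Real.cos w.re := by nlinarith
          exact mul_le_mul_of_nonneg_left h2.le this
  have key := eqOn_rect_of_eqOn_real (c := 0) (A := s) (L := |χ| + s) (f := H ε)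
    (g := fun w => (b₀ : ℂ) + b₁ * Complex.cos (4 * w) + b₂ * Complex.cos (8 * w))
    ((hH ε hε).mono hsub) (by fun_prop) ?_
  · have hmem : (χ : ℂ) * I ∈ {w : ℂ | |w.re - 0| < s ∧ |w.im| < |χ| + s} := by
      constructor
      · simp [hs0]
      · simp [hs0]
    rw [key hmem]
    simp only
    rw [show (4 : ℂ) * (χ * I) = (4 * χ : ℝ) * I by push_cast; ring,
      show (8 : ℂ) * (χ * I) = (8 * χ : ℝ) * I by push_cast; ring,
      Complex.cos_mul_I, Complex.cos_mul_I]
    push_cast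
    ring
  · intro r hr
    rw [sub_zero] at hr
    have hle : ε ≤ t * Real.cos r := by
      have h1 := hcosle r hr
      have h2 : Real.exp (-(|χ| + s)) ≤ 1 := by
        rw [Real.exp_le_one_iff]; linarith [abs_nonneg χ]
      have h3 : t * Real.cos s * Real.exp (-(|χ| + s)) ≤ t * Real.cos s := by
        have : 0 ≤ t * Real.cos s := by positivity
        nlinarith
      nlinarith
    rw [hreal ε hε r hle, hb r]
    push_cast
    ring

end Abstract

end AngleBandLimit

/-! ## The stub -/

open AngleBandLimit in
/-- **Stub A · the angle band limit with its chart identity.** `K : ℝ⁴ → ℝ` with a decay window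
`|K x| ≤ C(1 + ‖x‖^{-a})`, `0 < a < 12`, invariant under the rotation `R_{π/2}` of the
`(0,1)`-plane and under `x₁ ↦ -x₁`, and represented along the time axis, for every level `ε > 0`,
by a finite positive measure `μ ε` carried by the light cone `{p₀ ≥ |p₁|}`:
`K((ε+t)e₀ + v) = ∫ e^{-t p₀ + i⟪v,p⟫} d(μ ε)` (`t ≥ 0`, `v ⊥ e₀`). Then for every `t > 0` and
transverse `(y,z)` the angular trace is a real trigonometric polynomial `b₀ + b₁ cos 4φ + b₂ cos 8φ`,
and its value at the imaginary angle `iχ` is the chart integral at any level `ε < t e^{-|χ|}`.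
Proof: the charts of `AngleBandLimitChart` glue to a `π/2`-periodic entire function of exponential
type `a` (`AngleBandLimit.exists_entire_extension`), which is band-limited
(`bandlimit_main`, `a < 12`; `AngleBandLimit.cos_expansion`), and the chart identity at `iχ` is the
identity theorem on a rectangle in the lens (`AngleBandLimit.chart_imaginary_angle`). -/
theorem stub_angleBandLimit (K : E4 → ℝ) (C a : ℝ) (ha : 0 < a) (ha12 : a < 12)
    (hdecay : ∀ x : E4, x ≠ 0 → |K x| ≤ C * (1 + ‖x‖ ^ (-a)))
    (hrot : ∀ x : E4, K (WithLp.toLp 2 ![-x 1, x 0, x 2, x 3]) = K x)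
    (hflip : ∀ x : E4, K (WithLp.toLp 2 ![x 0, -x 1, x 2, x 3]) = K x)
    (μ : ℝ → Measure E4) (hfin : ∀ ε : ℝ, 0 < ε → IsFiniteMeasure (μ ε))
    (hE : ∀ ε : ℝ, 0 < ε → μ ε {p : E4 | p 0 < 0} = 0)
    (hcone : ∀ ε : ℝ, 0 < ε → μ ε {p : E4 | p 0 < |p 1|} = 0)
    (hrep : ∀ ε : ℝ, 0 < ε → ∀ t : ℝ, 0 ≤ t → ∀ v : E4, v 0 = 0 →
      ((K (EuclideanSpace.single 0 (ε + t) + v) : ℝ) : ℂ) =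
        ∫ p, Complex.exp ((((-(t * p 0) : ℝ)) : ℂ) + ((⟪v, p⟫_ℝ : ℝ) : ℂ) * Complex.I) ∂(μ ε)) :
    ∃ b : Fin 3 → ℝ → ℝ → ℝ → ℝ, ∀ t : ℝ, 0 < t → ∀ y z : ℝ,
      (∀ φ : ℝ, K (WithLp.toLp 2 ![t * Real.cos φ, t * Real.sin φ, y, z]) =
        b 0 t y z + b 1 t y z * Real.cos (4 * φ) + b 2 t y z * Real.cos (8 * φ)) ∧
      (∀ χ ε : ℝ, 0 < ε → ε < t * Real.exp (-|χ|) →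
        (((b 0 t y z + b 1 t y z * Real.cosh (4 * χ) + b 2 t y z * Real.cosh (8 * χ) : ℝ)) : ℂ) =
          ∫ p, Complex.exp ((((-((t * Real.cosh χ - ε) * p 0 + t * Real.sinh χ * p 1)) : ℝ) : ℂ) +
            ((y * p 2 + z * p 3 : ℝ) : ℂ) * Complex.I) ∂(μ ε)) := by
  have _hE := hE
  have main : ∀ t y z : ℝ, ∃ b : Fin 3 → ℝ, 0 < t →
      (∀ φ : ℝ, K (WithLp.toLp 2 ![t * Real.cos φ, t * Real.sin φ, y, z]) =
        b 0 + b 1 * Real.cos (4 * φ) + b 2 * Real.cos (8 * φ)) ∧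
      (∀ χ ε : ℝ, 0 < ε → ε < t * Real.exp (-|χ|) →
        (((b 0 + b 1 * Real.cosh (4 * χ) + b 2 * Real.cosh (8 * χ) : ℝ)) : ℂ) =
          ∫ p, Complex.exp ((((-((t * Real.cosh χ - ε) * p 0 + t * Real.sinh χ * p 1)) : ℝ) : ℂ) +
            ((y * p 2 + z * p 3 : ℝ) : ℂ) * Complex.I) ∂(μ ε)) := by
    intro t y z
    by_cases ht : 0 < t
    swap
    · exact ⟨0, fun h => absurd h ht⟩
    -- the angular trace and its charts
    set g : ℝ → ℝ := fun α => K (WithLp.toLp 2 ![t * Real.cos α, t * Real.sin α, y, z]) with hg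
    set H : ℝ → ℂ → ℂ := fun ε w => ∫ p, cexp (-((t : ℂ) * Complex.cos w - ε) * (p 0 : ℂ) +
        ((t : ℂ) * Complex.sin w * (p 1 : ℂ) + ((y * p 2 + z * p 3 : ℝ) : ℂ)) * I) ∂(μ ε) with hH
    have pkg : ∀ ε : ℝ, 0 < ε →
        DifferentiableOn ℂ (H ε) {w : ℂ | ε < t * Real.cos w.re * Real.exp (-|w.im|)} ∧
        (∀ α : ℝ, ε ≤ t * Real.cos α → H ε α = g α) ∧
        (∀ w : ℂ, ε < t * Real.cos w.re * Real.exp (-|w.im|) →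
          ‖H ε w‖ ≤ C * (1 + (t * Real.cos w.re * Real.exp (-|w.im|)) ^ (-a))) ∧
        (∀ χ : ℝ, H ε (χ * I) =
          ∫ p, cexp ((((-((t * Real.cosh χ - ε) * p 0 + t * Real.sinh χ * p 1)) : ℝ) : ℂ) +
            ((y * p 2 + z * p 3 : ℝ) : ℂ) * I) ∂(μ ε)) := by
      intro ε hε
      haveI := hfin ε hε
      exact stub_angleBandLimitChart (μ ε) (hcone ε hε) K C a t ε y z hε hdecay (hrep ε hε) (H ε)
        fun w => rfl
    have hHd : ∀ ε : ℝ, 0 < ε →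
        DifferentiableOn ℂ (H ε) {w : ℂ | ε < t * Real.cos w.re * Real.exp (-|w.im|)} :=
      fun ε hε => (pkg ε hε).1
    have hreal : ∀ ε : ℝ, 0 < ε → ∀ α : ℝ, ε ≤ t * Real.cos α → H ε α = g α :=
      fun ε hε => (pkg ε hε).2.1
    have hbd : ∀ ε : ℝ, 0 < ε → ∀ w : ℂ, ε < t * Real.cos w.re * Real.exp (-|w.im|) →
        ‖H ε w‖ ≤ C * (1 + (t * Real.cos w.re * Real.exp (-|w.im|)) ^ (-a)) :=
      fun ε hε => (pkg ε hε).2.2.1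
    have hper : ∀ α : ℝ, g (α + π / 2) = g α := by
      intro α
      simp only [hg, Real.cos_add_pi_div_two, Real.sin_add_pi_div_two]
      have h := hrot (WithLp.toLp 2 ![t * Real.cos α, t * Real.sin α, y, z])
      simpa using h
    have heven : ∀ α : ℝ, g (-α) = g α := by
      intro α
      simp only [hg, Real.cos_neg, Real.sin_neg]
      have h := hflip (WithLp.toLp 2 ![t * Real.cos α, t * Real.sin α, y, z])
      simpa using h
    obtain ⟨b₀, b₁, b₂, hb⟩ := cos_expansion ht ha ha12 hHd hreal hbd hper heven
    refine ⟨![b₀, b₁, b₂], fun _ => ⟨fun φ => ?_, fun χ ε hε hεχ => ?_⟩⟩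
    · simpa using hb φ
    · have h1 := chart_imaginary_angle ht hHd hreal hb hε hεχ
      simp only [Matrix.cons_val_zero, Matrix.cons_val_one, Matrix.cons_val_two, Matrix.head_cons,
        Matrix.tail_cons]
      rw [h1]
      exact (pkg ε hε).2.2.2 χ
  choose b hb using main
  exact ⟨fun i t y z => b t y z i, fun t ht y z => hb t y z ht⟩

end Summit.QuantumFields.YangMills.Cruxes.ShellRigidity.ThalesSlitExactConeType
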